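import Literature.Geometry.ComplexHyperbolic.UnitBallU21

/-!
# Entry bounds for `U(2,1)` from the ball geometry

Elementary estimates on the matrix entries of an element `g ∈ U(2,1)` (`J = diag(1,1,-1)`), the
input of the PROPER DISCONTINUITY of arithmetic subgroups acting on the ball `𝔹²`
(`Literature/AlgebraicGeometry/ShimuraVarieties/UnitaryBallDiscontinuity.lean`):

* the column / row identities `|g₀ⱼ|² + |g₁ⱼ|² - |g₂ⱼ|² = J_jj`, `|g_i0|² + |g_i1|² - |g_i2|² = J_ii`
  (`gᴴ J g = J` and `g J gᴴ = J`, `mat_mul_J_mul_conjTranspose`);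
* **every entry is dominated by the corner entry**: `‖g i j‖ ≤ ‖g 2 2‖`, and `1 ≤ ‖g 2 2‖`
  (`norm_entry_le_norm_22`, `one_le_norm_22`);
* **the corner entry is the distance of `g·0` to the boundary**: `‖g 2 2‖² · (1 - |g·0|²) = 1`
  (`norm_22_sq_mul_one_sub_nsq`), so `|g·0|² ≤ 1 - ε ⇒ ‖g 2 2‖² ≤ 1/ε`;
* the inverse `g⁻¹ = J gᴴ J` has the transposed entry norms (`norm_mat_inv_apply`);
* the **two-point bound**: if `g z = w` with `|z|², |w|² ≤ 1 - ε` then `‖g i j‖ ≤ 3/ε` for all `i, j`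
  (`norm_entry_le_of_smul_eq`; write `g = (g h) h⁻¹` with `h·0 = z`), and its compact form: for compact
  `K, L ⊆ 𝔹²` there is `R` with `‖g i j‖ ≤ R` whenever `g K ∩ L ≠ ∅` (`exists_norm_entry_le_of_isCompact`);
* topological facts on `𝔹²` used downstream: it is Hausdorff and locally compact (an open subset of `ℂ²`).

Everything here is PROVED; these are the standard estimates behind "`U(n,1)` acts properly on the
ball" (the stabiliser of `0` is the compact group `U(2) × U(1)`, and `g ↦ g·0` is proper).

References: W. Rudin, *Function Theory in the Unit Ball of ℂⁿ* (Springer 1980), §2.2 (the automorphisms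
`φ_a`, Thm 2.2.3); H. Jacobowitz, *An Introduction to CR Structures* (AMS 1990), Ch. 2 §1 Lemma 6
(isotropy of the origin is `U(1) × U(2)`).

## Provenance

Written under the LEAN-IN-TREE rule for the pub-hodgecm formalisation cell (model-construction sub-cell,
seat mc-autform-1 gen 2, MODEL-DAG node D1-G-iii-c: descent of holomorphic automorphic forms to the
ball quotient). Nothing in this file is a claim of the manuscripts adjudicated by that cell.
-/

set_option autoImplicit false

noncomputable section

open Matrix Complex ComplexConjugate

namespace Literature.Geometry.ComplexHyperbolic

namespace BallModel

/-! ### `J² = 1` and the relation for `gᴴ` -/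

/-- `J² = 1`. [folklore] -/
theorem J_mul_J : J * J = 1 := by
  rw [J, Matrix.diagonal_mul_diagonal, ← Matrix.diagonal_one]
  congr 1
  funext i
  fin_cases i <;> simp

/-- The diagonal entries of `J` have norm `1`. [folklore] -/
theorem norm_J_apply_self (i : Fin 3) : ‖J i i‖ = 1 := by
  fin_cases i <;> simp [J]

/-- `g (J gᴴ J) = 1`: `J gᴴ J` is a two-sided inverse of `g`. [folklore] -/
theorem mat_mul_J_conjTranspose_J (g : U21) : mat g * (J * (mat g)ᴴ * J) = 1 := by
  have h : J * (mat g)ᴴ * J * mat g = 1 := by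
    calc J * (mat g)ᴴ * J * mat g = J * ((mat g)ᴴ * J * mat g) := by
          simp only [Matrix.mul_assoc]
      _ = 1 := by rw [mat_mem g, J_mul_J]
  exact mul_eq_one_comm.1 h

/-- **`g J gᴴ = J`** for `g ∈ U(2,1)` (so `gᴴ ∈ U(2,1)` too). [folklore] -/
theorem mat_mul_J_mul_conjTranspose (g : U21) : mat g * J * (mat g)ᴴ = J := by
  have h := congrArg (· * J) (mat_mul_J_conjTranspose_J g)
  simp only [Matrix.mul_assoc, J_mul_J, Matrix.mul_one, Matrix.one_mul] at h
  simpa only [Matrix.mul_assoc] using h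

/-- The relation in the form `(gᴴ)ᴴ J gᴴ = J`. [folklore] -/
theorem conjTranspose_mem (g : U21) : ((mat g)ᴴ)ᴴ * J * (mat g)ᴴ = J := by
  rw [conjTranspose_conjTranspose]
  exact mat_mul_J_mul_conjTranspose g

/-- The matrix of `g⁻¹` is `J gᴴ J`. [folklore] -/
theorem mat_inv (g : U21) : mat g⁻¹ = J * (mat g)ᴴ * J := by
  have h1 : mat g⁻¹ * mat g = 1 := by rw [← mat_mul, inv_mul_cancel, mat_one]
  calc mat g⁻¹ = mat g⁻¹ * (mat g * (J * (mat g)ᴴ * J)) := by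
        rw [mat_mul_J_conjTranspose_J, Matrix.mul_one]
    _ = J * (mat g)ᴴ * J := by rw [← Matrix.mul_assoc, h1, Matrix.one_mul]

/-- Entries of the inverse: `‖(g⁻¹) i j‖ = ‖g j i‖`. [folklore] -/
theorem norm_mat_inv_apply (g : U21) (i j : Fin 3) : ‖mat g⁻¹ i j‖ = ‖mat g j i‖ := by
  rw [mat_inv, J, Matrix.mul_assoc, Matrix.diagonal_mul, Matrix.mul_diagonal, conjTranspose_apply,
    norm_mul, norm_mul, norm_star]
  have hi : ‖(![1, 1, -1] : Fin 3 → ℂ) i‖ = 1 := by fin_cases i <;> simp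
  have hj : ‖(![1, 1, -1] : Fin 3 → ℂ) j‖ = 1 := by fin_cases j <;> simp
  rw [hi, hj, one_mul, mul_one]

/-! ### Column and row identities -/

/-- `Q` of a coordinate vector: `Q eⱼ = J_jj`, i.e. `1, 1, -1`. [folklore] -/
theorem Q_single (j : Fin 3) : Q (Pi.single j (1 : ℂ)) = if j = 2 then -1 else 1 := by
  fin_cases j <;> simp [Q]

/-- The `j`-th column of `g` is `g eⱼ`. [folklore] -/
theorem mulVec_single_one (M : Matrix (Fin 3) (Fin 3) ℂ) (j : Fin 3) :
    M *ᵥ Pi.single j 1 = fun i ↦ M i j := by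
  funext i
  rw [Matrix.mulVec, dotProduct]
  simp only [Pi.single_apply, mul_ite, mul_one, mul_zero, Finset.sum_ite_eq', Finset.mem_univ,
    if_true]

/-- **Column identity**: `‖g₀ⱼ‖² + ‖g₁ⱼ‖² - ‖g₂ⱼ‖² = J_jj`. [folklore] -/
theorem col_identity (g : U21) (j : Fin 3) :
    ‖mat g 0 j‖ ^ 2 + ‖mat g 1 j‖ ^ 2 - ‖mat g 2 j‖ ^ 2 = if j = 2 then -1 else 1 := by
  have h := Q_mulVec (mat_mem g) (Pi.single j 1)
  rw [mulVec_single_one, Q_single] at h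
  simpa [Q] using h

/-- **Row identity**: `‖g_i0‖² + ‖g_i1‖² - ‖g_i2‖² = J_ii`. [folklore] -/
theorem row_identity (g : U21) (i : Fin 3) :
    ‖mat g i 0‖ ^ 2 + ‖mat g i 1‖ ^ 2 - ‖mat g i 2‖ ^ 2 = if i = 2 then -1 else 1 := by
  have h := Q_mulVec (conjTranspose_mem g) (Pi.single i 1)
  rw [mulVec_single_one, Q_single] at h
  simpa [Q, conjTranspose_apply] using h

/-- `1 ≤ ‖g 2 2‖`. [folklore] -/
theorem one_le_norm_22 (g : U21) : 1 ≤ ‖mat g 2 2‖ := by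
  have h := col_identity g 2
  simp only [if_true] at h
  have h2 : 1 ≤ ‖mat g 2 2‖ ^ 2 := by nlinarith [sq_nonneg ‖mat g 0 2‖, sq_nonneg ‖mat g 1 2‖]
  exact (one_le_sq_iff₀ (norm_nonneg _)).1 h2

/-- `0 < ‖g 2 2‖`. [folklore] -/
theorem norm_22_pos (g : U21) : 0 < ‖mat g 2 2‖ :=
  lt_of_lt_of_le one_pos (one_le_norm_22 g)

/-- **Every entry is dominated by the corner entry**: `‖g i j‖ ≤ ‖g 2 2‖`. [folklore] -/
theorem norm_entry_le_norm_22 (g : U21) (i j : Fin 3) : ‖mat g i j‖ ≤ ‖mat g 2 2‖ := by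
  have hsq : ‖mat g i j‖ ^ 2 ≤ ‖mat g 2 2‖ ^ 2 := by
    have hc2 := col_identity g 2
    have hr2 := row_identity g 2
    have hcj := col_identity g j
    simp only [if_true] at hc2 hr2
    fin_cases i <;> fin_cases j <;>
      simp only [Fin.zero_eta, Fin.mk_one, Fin.reduceFinMk, Fin.isValue, if_true,
        if_false, show (0 : Fin 3) ≠ 2 by decide, show (1 : Fin 3) ≠ 2 by decide] at hcj ⊢ <;>
      nlinarith [sq_nonneg ‖mat g 0 0‖, sq_nonneg ‖mat g 0 1‖, sq_nonneg ‖mat g 0 2‖,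
        sq_nonneg ‖mat g 1 0‖, sq_nonneg ‖mat g 1 1‖, sq_nonneg ‖mat g 1 2‖,
        sq_nonneg ‖mat g 2 0‖, sq_nonneg ‖mat g 2 1‖, sq_nonneg ‖mat g 2 2‖,
        col_identity g 0, col_identity g 1]
  exact (pow_le_pow_iff_left₀ (norm_nonneg _) (norm_nonneg _) two_ne_zero).1 hsq

/-! ### The corner entry and the image of the origin -/

/-- `g·0` has coordinates `g_{i2} / g_{22}`. [folklore] -/
theorem smul_x₀_val (g : U21) (i : Fin 2) : (g • x₀).1 i = mat g (Fin.castSucc i) 2 / mat g 2 2 := by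
  rw [smul_val, W3_apply, W3_apply]
  simp

/-- **`‖g 2 2‖² (1 - |g·0|²) = 1`**: the corner entry measures the distance of `g·0` to the boundary
sphere. [cite: Rudin1980, Thm 2.2.2] -/
theorem norm_22_sq_mul_one_sub_nsq (g : U21) : ‖mat g 2 2‖ ^ 2 * (1 - nsq (g • x₀).1) = 1 := by
  have h := col_identity g 2
  simp only [if_true] at h
  have hpos := norm_22_pos g
  have hnsq : nsq (g • x₀).1 = (‖mat g 0 2‖ ^ 2 + ‖mat g 1 2‖ ^ 2) / ‖mat g 2 2‖ ^ 2 := by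
    rw [nsq, smul_x₀_val, smul_x₀_val, norm_div, norm_div, div_pow, div_pow, add_div]
    rfl
  rw [hnsq]
  field_simp
  linarith

/-- `1 - |g·0|² = 1 / ‖g 2 2‖²`. [folklore] -/
theorem one_sub_nsq_smul_x₀ (g : U21) : 1 - nsq (g • x₀).1 = 1 / ‖mat g 2 2‖ ^ 2 := by
  have h := norm_22_sq_mul_one_sub_nsq g
  have hpos : 0 < ‖mat g 2 2‖ ^ 2 := pow_pos (norm_22_pos g) 2
  rw [eq_div_iff hpos.ne', mul_comm]
  exact h

/-- If `|g·0|² ≤ 1 - ε` then `‖g 2 2‖² ≤ 1/ε`. [folklore] -/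
theorem norm_22_sq_le {g : U21} {ε : ℝ} (hε : 0 < ε) (h : nsq (g • x₀).1 ≤ 1 - ε) :
    ‖mat g 2 2‖ ^ 2 ≤ 1 / ε := by
  have h1 := norm_22_sq_mul_one_sub_nsq g
  have hpos : 0 < ‖mat g 2 2‖ ^ 2 := pow_pos (norm_22_pos g) 2
  rw [le_div_iff₀ hε]
  nlinarith

/-! ### Products and the two-point bound -/

/-- Entry bound for a product of `3 × 3` matrices. [folklore] -/
theorem norm_mul_apply_le {M N : Matrix (Fin 3) (Fin 3) ℂ} {R S : ℝ} (hM : ∀ i j, ‖M i j‖ ≤ R)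
    (hN : ∀ i j, ‖N i j‖ ≤ S) (i j : Fin 3) : ‖(M * N) i j‖ ≤ 3 * (R * S) := by
  rw [Matrix.mul_apply]
  calc ‖∑ k, M i k * N k j‖ ≤ ∑ k, ‖M i k * N k j‖ := norm_sum_le _ _
    _ ≤ ∑ _k : Fin 3, R * S := Finset.sum_le_sum fun k _ ↦ by
        rw [norm_mul]
        exact mul_le_mul (hM i k) (hN k j) (norm_nonneg _) ((norm_nonneg _).trans (hM i k))
    _ = 3 * (R * S) := by simp

/-- **Two-point bound.** If `g z = w` with `|z|², |w|² ≤ 1 - ε` (`0 < ε`), then every entry of `g`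
has norm `≤ 3/ε`. (Write `g = (g h) h⁻¹` with `h·0 = z`; the corner entries of `g h` and `h` are
`≤ ε^{-1/2}` by `norm_22_sq_le`, and they dominate all entries.) [cite: Rudin1980, Thm 2.2.2] -/
theorem norm_entry_le_of_smul_eq {ε : ℝ} (hε : 0 < ε) {g : U21} {z w : Ball}
    (hz : nsq z.1 ≤ 1 - ε) (hw : nsq w.1 ≤ 1 - ε) (h : g • z = w) (i j : Fin 3) :
    ‖mat g i j‖ ≤ 3 / ε := by
  obtain ⟨k, hk⟩ := exists_smul_x₀_eq z
  have hgk : (g * k) • x₀ = w := by rw [mul_smul, hk, h]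
  have hR : ‖mat (g * k) 2 2‖ ^ 2 ≤ 1 / ε := norm_22_sq_le hε (by rw [hgk]; exact hw)
  have hS : ‖mat k 2 2‖ ^ 2 ≤ 1 / ε := norm_22_sq_le hε (by rw [hk]; exact hz)
  have hM : ∀ a b, ‖mat (g * k) a b‖ ≤ ‖mat (g * k) 2 2‖ := norm_entry_le_norm_22 (g * k)
  have hN : ∀ a b, ‖mat k⁻¹ a b‖ ≤ ‖mat k 2 2‖ := fun a b ↦ by
    rw [norm_mat_inv_apply]
    exact norm_entry_le_norm_22 k b a
  have hprod : ‖mat (g * k) 2 2‖ * ‖mat k 2 2‖ ≤ 1 / ε := by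
    have hsq : (‖mat (g * k) 2 2‖ * ‖mat k 2 2‖) ^ 2 ≤ (1 / ε) ^ 2 := by
      rw [mul_pow, sq (1 / ε)]
      exact mul_le_mul hR hS (sq_nonneg _) (by positivity)
    exact (pow_le_pow_iff_left₀ (by positivity) (by positivity) two_ne_zero).1 hsq
  have hg : mat g = mat (g * k) * mat k⁻¹ := by rw [← mat_mul, mul_inv_cancel_right]
  rw [hg]
  calc ‖(mat (g * k) * mat k⁻¹) i j‖ ≤ 3 * (‖mat (g * k) 2 2‖ * ‖mat k 2 2‖) :=
        norm_mul_apply_le hM hN i j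
    _ ≤ 3 * (1 / ε) := by gcongr
    _ = 3 / ε := by ring

/-! ### Topology of the ball and the compact form of the bound -/

/-- `z ↦ |z|²` is continuous on `ℂ²`. [folklore] -/
theorem continuous_fun_nsq : Continuous fun z : Fin 2 → ℂ ↦ nsq z := by
  unfold nsq
  fun_prop

/-- The ball is Hausdorff. [folklore] -/
instance instT2SpaceBall : T2Space Ball := by
  unfold Ball; infer_instance

/-- The ball is locally compact (an open subset of `ℂ²`). [folklore] -/
instance instLocallyCompactSpaceBall : LocallyCompactSpace Ball := by
  have h : IsOpen {z : Fin 2 → ℂ | nsq z < 1} := isOpen_lt continuous_fun_nsq continuous_const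
  unfold Ball
  exact h.locallyCompactSpace

/-- A compact subset of the ball stays away from the boundary: `|z|² ≤ 1 - ε` on it for some `ε > 0`.
[folklore] -/
theorem exists_nsq_le_of_isCompact {K : Set Ball} (hK : IsCompact K) :
    ∃ ε : ℝ, 0 < ε ∧ ∀ z ∈ K, nsq z.1 ≤ 1 - ε := by
  rcases K.eq_empty_or_nonempty with rfl | hne
  · exact ⟨1, one_pos, fun z hz ↦ (Set.notMem_empty z hz).elim⟩
  have hc : Continuous fun z : Ball ↦ nsq z.1 := continuous_fun_nsq.comp continuous_subtype_val
  obtain ⟨z₀, hz₀, hmax⟩ := hK.exists_isMaxOn hne hc.continuousOn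
  refine ⟨1 - nsq z₀.1, by linarith [z₀.2], fun z hz ↦ ?_⟩
  have h' : nsq z.1 ≤ nsq z₀.1 := hmax hz
  linarith

/-- **Compact form of the two-point bound**: for compact `K, L ⊆ 𝔹²` there is `R` such that every
`g ∈ U(2,1)` moving a point of `K` into `L` has all entries of norm `≤ R`. [cite: Rudin1980, Thm 2.2.2] -/
theorem exists_norm_entry_le_of_isCompact {K L : Set Ball} (hK : IsCompact K) (hL : IsCompact L) :
    ∃ R : ℝ, ∀ g : U21, ∀ z ∈ K, g • z ∈ L → ∀ i j, ‖mat g i j‖ ≤ R := by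
  obtain ⟨ε₁, hε₁, h₁⟩ := exists_nsq_le_of_isCompact hK
  obtain ⟨ε₂, hε₂, h₂⟩ := exists_nsq_le_of_isCompact hL
  refine ⟨3 / min ε₁ ε₂, fun g z hz hgz i j ↦ ?_⟩
  have hε : 0 < min ε₁ ε₂ := lt_min hε₁ hε₂
  exact norm_entry_le_of_smul_eq hε ((h₁ z hz).trans (by gcongr; exact min_le_left _ _))
    ((h₂ _ hgz).trans (by gcongr; exact min_le_right _ _)) rfl i j

end BallModel

end Literature.Geometry.ComplexHyperbolic

end
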